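import Summits.MatrixMultiplication.MatrixMultiplication.Theorems.OutsiderSandwichToricCeilingPowTwoCwBaseDataB
import Summits.MatrixMultiplication.MatrixMultiplication.Theorems.OutsiderSandwichToricCeilingPowTwoCwBaseDataTwoA
import Summits.MatrixMultiplication.MatrixMultiplication.Theorems.OutsiderSandwichToricCeilingPowTwoCwBaseDataTwoB

/-!
# OutsiderSandwich — toric ceiling of `cw₂^{⊠N}`: the `N = 3` two-cw base, TWO-NESS census B
(groups `cX3`, `cX4`, `cX5`; decomp-mm lens 4, gen 47, kernel K47-8 census B; THESES-FREE, `ω`-free;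
helper toward `LaserTangency`, stmt-32268)

LABEL.  TORIC · FINITE (`N = 3`) · NEC-side instrument.  For each group `cXk`, in CHUNKS of at
most 120 instances (kernel memory ceiling on the gate): the second certificate `datbk[i]`
(`…TwoCwBaseDataTwoB`) decodes to a `valid` perfect matching of the instance `(instOf cXk)[i]`
which misses a row of the matching decoded from the first certificate `datak[i]`
(`…TwoCwBaseDataB`) — `census₂_k_r`, `decide +kernel`, standard axioms (no `native_decide`, no
`ofReduceBool`); `lenbk`, `dlenbk`, `cover₂_k` are bookkeeping.  Consumed by `…TwoCwBaseTwo`.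
WHAT THIS IS NOT: no statement about tensors or `ω`.
-/

set_option linter.dupNamespace false
set_option maxRecDepth 200000
set_option Elab.async false

namespace Summit.MatrixMultiplication.MatrixMultiplication.Theorems.OutsiderSandwichToricCeilingPowTwoCwBaseCensusTwoB

open Summit.MatrixMultiplication.MatrixMultiplication.Theorems.OutsiderSandwichToricCeilingPowTwoCwBaseDefs
open Summit.MatrixMultiplication.MatrixMultiplication.Theorems.OutsiderSandwichToricCeilingPowTwoCwBaseDataB
open Summit.MatrixMultiplication.MatrixMultiplication.Theorems.OutsiderSandwichToricCeilingPowTwoCwBaseDataTwoA (goodD₂)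
open Summit.MatrixMultiplication.MatrixMultiplication.Theorems.OutsiderSandwichToricCeilingPowTwoCwBaseDataTwoB

set_option maxHeartbeats 0 in
/-- Group `cX3`: the second-certificate list has the length of the instance list (340). -/
theorem lenb3 : (instOf cX3).length = datb3.length := by
  decide +kernel

/-- Group `cX3`: number of second certificates. -/
theorem dlenb3 : datb3.length = 340 := by
  decide +kernel

set_option maxHeartbeats 0 in
/-- TWO-NESS CENSUS, group `cX3`, instances `0 … 119` (kernel-decided): each second
certificate decodes to a valid perfect matching missing a row of the first one. -/
theorem census₂_3_0 : ((((instOf cX3).zip (data3.zip datb3)).drop 0).take 120).all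
    (fun p => goodD₂ p.1 p.2.1 p.2.2) = true := by
  decide +kernel

set_option maxHeartbeats 0 in
/-- TWO-NESS CENSUS, group `cX3`, instances `120 … 239` (kernel-decided): each second
certificate decodes to a valid perfect matching missing a row of the first one. -/
theorem census₂_3_1 : ((((instOf cX3).zip (data3.zip datb3)).drop 120).take 120).all
    (fun p => goodD₂ p.1 p.2.1 p.2.2) = true := by
  decide +kernel

set_option maxHeartbeats 0 in
/-- TWO-NESS CENSUS, group `cX3`, instances `240 … 339` (kernel-decided): each second
certificate decodes to a valid perfect matching missing a row of the first one. -/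
theorem census₂_3_2 : ((((instOf cX3).zip (data3.zip datb3)).drop 240).take 100).all
    (fun p => goodD₂ p.1 p.2.1 p.2.2) = true := by
  decide +kernel

/-- Group `cX3`: every index is covered by a decided chunk. -/
theorem cover₂_3 : ∀ i < datb3.length, ∃ lo n, lo ≤ i ∧ i < lo + n ∧
    ((((instOf cX3).zip (data3.zip datb3)).drop lo).take n).all
      (fun p => goodD₂ p.1 p.2.1 p.2.2) = true := by
  intro i hi
  rw [dlenb3] at hi
  by_cases h0 : i < 120
  · exact ⟨0, 120, by omega, by omega, census₂_3_0⟩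
  by_cases h1 : i < 240
  · exact ⟨120, 120, by omega, by omega, census₂_3_1⟩
  · exact ⟨240, 100, by omega, by omega, census₂_3_2⟩

set_option maxHeartbeats 0 in
/-- Group `cX4`: the second-certificate list has the length of the instance list (184). -/
theorem lenb4 : (instOf cX4).length = datb4.length := by
  decide +kernel

/-- Group `cX4`: number of second certificates. -/
theorem dlenb4 : datb4.length = 184 := by
  decide +kernel

set_option maxHeartbeats 0 in
/-- TWO-NESS CENSUS, group `cX4`, instances `0 … 119` (kernel-decided): each second
certificate decodes to a valid perfect matching missing a row of the first one. -/
theorem census₂_4_0 : ((((instOf cX4).zip (data4.zip datb4)).drop 0).take 120).all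
    (fun p => goodD₂ p.1 p.2.1 p.2.2) = true := by
  decide +kernel

set_option maxHeartbeats 0 in
/-- TWO-NESS CENSUS, group `cX4`, instances `120 … 183` (kernel-decided): each second
certificate decodes to a valid perfect matching missing a row of the first one. -/
theorem census₂_4_1 : ((((instOf cX4).zip (data4.zip datb4)).drop 120).take 64).all
    (fun p => goodD₂ p.1 p.2.1 p.2.2) = true := by
  decide +kernel

/-- Group `cX4`: every index is covered by a decided chunk. -/
theorem cover₂_4 : ∀ i < datb4.length, ∃ lo n, lo ≤ i ∧ i < lo + n ∧
    ((((instOf cX4).zip (data4.zip datb4)).drop lo).take n).all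
      (fun p => goodD₂ p.1 p.2.1 p.2.2) = true := by
  intro i hi
  rw [dlenb4] at hi
  by_cases h0 : i < 120
  · exact ⟨0, 120, by omega, by omega, census₂_4_0⟩
  · exact ⟨120, 64, by omega, by omega, census₂_4_1⟩

set_option maxHeartbeats 0 in
/-- Group `cX5`: the second-certificate list has the length of the instance list (376). -/
theorem lenb5 : (instOf cX5).length = datb5.length := by
  decide +kernel

/-- Group `cX5`: number of second certificates. -/
theorem dlenb5 : datb5.length = 376 := by
  decide +kernel

set_option maxHeartbeats 0 in
/-- TWO-NESS CENSUS, group `cX5`, instances `0 … 119` (kernel-decided): each second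
certificate decodes to a valid perfect matching missing a row of the first one. -/
theorem census₂_5_0 : ((((instOf cX5).zip (data5.zip datb5)).drop 0).take 120).all
    (fun p => goodD₂ p.1 p.2.1 p.2.2) = true := by
  decide +kernel

set_option maxHeartbeats 0 in
/-- TWO-NESS CENSUS, group `cX5`, instances `120 … 239` (kernel-decided): each second
certificate decodes to a valid perfect matching missing a row of the first one. -/
theorem census₂_5_1 : ((((instOf cX5).zip (data5.zip datb5)).drop 120).take 120).all
    (fun p => goodD₂ p.1 p.2.1 p.2.2) = true := by
  decide +kernel

set_option maxHeartbeats 0 in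
/-- TWO-NESS CENSUS, group `cX5`, instances `240 … 359` (kernel-decided): each second
certificate decodes to a valid perfect matching missing a row of the first one. -/
theorem census₂_5_2 : ((((instOf cX5).zip (data5.zip datb5)).drop 240).take 120).all
    (fun p => goodD₂ p.1 p.2.1 p.2.2) = true := by
  decide +kernel

set_option maxHeartbeats 0 in
/-- TWO-NESS CENSUS, group `cX5`, instances `360 … 375` (kernel-decided): each second
certificate decodes to a valid perfect matching missing a row of the first one. -/
theorem census₂_5_3 : ((((instOf cX5).zip (data5.zip datb5)).drop 360).take 16).all
    (fun p => goodD₂ p.1 p.2.1 p.2.2) = true := by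
  decide +kernel

/-- Group `cX5`: every index is covered by a decided chunk. -/
theorem cover₂_5 : ∀ i < datb5.length, ∃ lo n, lo ≤ i ∧ i < lo + n ∧
    ((((instOf cX5).zip (data5.zip datb5)).drop lo).take n).all
      (fun p => goodD₂ p.1 p.2.1 p.2.2) = true := by
  intro i hi
  rw [dlenb5] at hi
  by_cases h0 : i < 120
  · exact ⟨0, 120, by omega, by omega, census₂_5_0⟩
  by_cases h1 : i < 240
  · exact ⟨120, 120, by omega, by omega, census₂_5_1⟩
  by_cases h2 : i < 360
  · exact ⟨240, 120, by omega, by omega, census₂_5_2⟩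
  · exact ⟨360, 16, by omega, by omega, census₂_5_3⟩

end Summit.MatrixMultiplication.MatrixMultiplication.Theorems.OutsiderSandwichToricCeilingPowTwoCwBaseCensusTwoB
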